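import Mathlib
import HarnessLib
import Summits.ValiantsHypothesis.ValiantsHypothesis.Theorems.MonotoneRestorationOrbitRestorationLinearVolumeQPSimplePatternVH

/-!
# A decider below the route's TARGET `NonnegRestorationQP`, in its own nonnegative size currency: the hom families of
# single simple sparse patterns

Route MonotoneRestoration.  The target X = `NonnegRestorationQP` (stmt-ValiantsHypothesis-16191) asks for square-symmetric
circuits of quasi-polynomial SIZE for every matrix-symmetric family over `ℝ≥0` whose complexification is in `VP`.
Homomorphism polynomials of bipartite patterns ARE such nonnegative families (coefficients in `ℕ`), and the separating
family of `…LinearVolumeQPSimplePatternVH.lean` consists of them.  Hence already the restriction of X to the hom families of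
single SIMPLE bipartite patterns with `≤ n` rows, columns and edges decides the summit:

* `map_homPoly` — `homPoly` commutes with ring maps (`ℝ≥0 → ℂ`);
* `valiantsHypothesis_of_nonnegSizeSimplePatternRestoration` — if every such hom family over `ℝ≥0` whose
  complexification is a `VP` family has square-symmetric circuits over `ℂ` of SIZE `≤ 2^((log₂ n + c)^c)` computing it,
  then `VP ≠ VNP` over `ℂ` (size bounds orbit, `LabelledArithCircuit.orbitSize_le_size`, and
  `valiantsHypothesis_of_simplePatternOrbitRestoration`).

Reading: X's hypothesis class contains a one-parameter sub-family (single sparse simple hom patterns) on which X is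
already VH-strength; the monotone-complexity crux `MonotoneRestorationQP` is NOT reached this way (the separating patterns
need not have small monotone circuits).  Honest framing: implication only; X, the cruxes and VP ≠ VNP remain open.
-/

noncomputable section

-- `Summit.ValiantsHypothesis.ValiantsHypothesis.…` is the tree's single-conjunct layout (Sub = Summit).
set_option linter.dupNamespace false

namespace Summit.ValiantsHypothesis.ValiantsHypothesis.Theorems

namespace OrbitRestorationLinearVolumeQPVHStrength

open MvPolynomial
open Summit.ValiantsHypothesis.ValiantsHypothesis.Theses.MonotoneRestoration
open Literature.Computability.AlgebraicComplexity
open Literature.ModelTheory.FiniteModelTheory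

/-- `homPoly` commutes with ring homomorphisms of the coefficients (it is a sum of products of variables).
[cite: DwivediPagoSeppelt2026, eq. (1)] -/
theorem map_homPoly {R S : Type*} [CommSemiring R] [CommSemiring S] (φ : R →+* S) {a b : ℕ}
    (E : Multiset (Fin a × Fin b)) (n : ℕ) :
    MvPolynomial.map φ (homPoly E n R) = homPoly E n S := by
  unfold homPoly
  simp only [map_sum, map_multiset_prod, Multiset.map_map, Function.comp_def, map_X]

/-- **The target restricted to single sparse simple hom patterns decides the summit.**  If every family
`(hom_{F_n,n})_n` over `ℝ≥0` of single SIMPLE bipartite patterns with `≤ n` rows, columns and edges whose complexification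
is a `VP` family has, for one constant `c` and every `n`, a square-symmetric circuit over `ℂ` of SIZE
`≤ 2^((log₂ n + c)^c)` computing its complexification (the conclusion of `NonnegRestorationQP`, verbatim), then
`VP ≠ VNP` over `ℂ`. [cite: DawarWilsenach2025, Thm 7.2, Thm 5.1, §6, §7.1; DwivediPagoSeppelt2026, Outlook Q3] -/
theorem valiantsHypothesis_of_nonnegSizeSimplePatternRestoration
    (h : ∀ (a b : ℕ → ℕ) (E : (n : ℕ) → Multiset (Fin (a n) × Fin (b n))),
      (∀ n, a n ≤ n) → (∀ n, b n ≤ n) → (∀ n, Multiset.card (E n) ≤ n) → (∀ n, (E n).Nodup) →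
      IsVPFamily (fun n => MvPolynomial.map (Complex.ofRealHom.comp NNReal.toRealHom) (homPoly (E n) n NNReal)) →
      ∃ c : ℕ, ∀ n : ℕ, ∃ (G : Type) (_ : Fintype G) (C : LabelledArithCircuit ℂ (Fin n × Fin n) Unit G),
        C.IsSymmetric (Equiv.Perm (Fin n)) ∧
          C.eval (C.output ()) = MvPolynomial.map (Complex.ofRealHom.comp NNReal.toRealHom) (homPoly (E n) n NNReal) ∧
          Fintype.card G ≤ 2 ^ ((Nat.log 2 n + c) ^ c)) :
    ValiantsHypothesis := by
  refine valiantsHypothesis_of_simplePatternOrbitRestoration fun a b E ha hb hE hnd hVP => ?_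
  have hVP' : IsVPFamily (fun n =>
      MvPolynomial.map (Complex.ofRealHom.comp NNReal.toRealHom) (homPoly (E n) n NNReal)) := by
    simp_rw [map_homPoly]
    exact hVP
  obtain ⟨c, hc⟩ := h a b E ha hb hE hnd hVP'
  refine ⟨c, fun n => ?_⟩
  obtain ⟨G, inst, C, hsym, hev, hcard⟩ := hc n
  refine ⟨G, inst, C, hsym, by rw [hev, map_homPoly], ?_⟩
  exact (C.orbitSize_le_size (Equiv.Perm (Fin n))).trans hcard

end OrbitRestorationLinearVolumeQPVHStrength

end Summit.ValiantsHypothesis.ValiantsHypothesis.Theorems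

end
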